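import Literature.Probability.RandomPlanarGeometry.SAWPulledLargeForceExpansionZdCostPolynomial
import HarnessLib

/-!
# Pulled SAW on `ℤ^{d+1}`: the DEGREE PROFILE of the cost census — `deg_d N_{c,n}(ℤ^{d+1}) ≤ 3c − 2n + 2`

Topic `Literature/Probability/RandomPlanarGeometry` (continues `SAWPulledLargeForceExpansionZdCostPolynomial.lean`: the axis-class
identity `costCoeffZd_eq_sum_choose_mul`, `N_{c,n}(ℤ^{d+1}) = Σ_{u ≤ c} C(d,u) · F_{c,n}(u)` with `F_{c,n}(u)` the number of cost-`c`,
length-`n` irreducible bridges of `ℤ^{u+1}` using every lateral axis; the span of such a bridge is `n − c`).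

PRINTED CONTEXT (locators only). Madras–Slade (1993) §1.1 eq. (1.1.8) p. 5 (the `1/d` expansion); §4.2, remark after Theorem 4.2.4
(p. 94): every internal level gap of an irreducible bridge is crossed at least three times (the tree's `three_mul_span_le`,
`SAWIrreducibleBridgeCrossings.lean`). Duminil-Copin–Hammond (2013) §2.2 (renewal times). NOT IN PRINT (lane statements): the rest.

* ★ `exists_down_step_of_irreducible` — an irreducible bridge of span `A` makes, for every internal level `g ∈ [1, A−1]`, a DOWN step
  from height `g + 1` to `g` (else the last arrival at level `g` before the first visit to `g + 1` is a renewal time); hence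
  ★ `span_sub_one_le_card_down` — it makes at least `A − 1` down steps;
* ★ `height_add_axes_add_two_mul_down_le` — height accounting: final height `+` (number of lateral axes used) `+ 2·`(number of down
  steps) `≤` length, for every self-avoiding walk of `ℤ^{u+1}` using all `u` lateral axes;
* ★★ `card_allAxesClass_eq_zero_of_lt` — `F_{c,n}(u) = 0` whenever `3c + 2 < 2n + u`: a cost-`c` irreducible bridge of length `n`
  (span `n − c`) uses at most `3c − 2n + 2` lateral axes;
* ★★★ `exists_polynomial_costCoeffZd_degree_profile` — `d ↦ N_{c,n}(ℤ^{d+1})` is a polynomial of degree `≤ 3c + 2 − 2n` (truncated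
  subtraction): the cells of maximal span `n = ⌊3c/2⌋ + 1` are at most quadratic in `d`, and only the span-one cell `n = c + 1` reaches
  degree `c` (lane data: the bound is attained in every nonzero cell with `c ≤ 8`);
* ★★ `costCoeffZd_eq_eval_of_eq_on_small` / `largeForceCoeffZd_eq_eval_of_eq_on_small` — FINITE DETERMINATION: a candidate all-`d`
  polynomial law for `N_{c,n}` (degree `≤ 3c + 2 − 2n`) or for `c_k^{(d)}` (degree `≤ k`) that is correct in the first `3c + 3 − 2n`
  (resp. `k + 1`) dimensions is correct in every dimension — the certification path for the lane's computed all-`d` laws.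
[cite: MadrasSlade1993, §1.1 eq. (1.1.8) p. 5; §4.2, remark after Theorem 4.2.4 (p. 94)] [cite: DuminilCopinHammond2013, §2.2]

Provenance: lane «pcv-sawmu», a-p1 g17 (2026-08-25). Data (not used; the statement was read off it): the largest `u` with
`F_{c,n}(u) ≠ 0` is `3c − 2n + 2` for every nonzero cell with `c ≤ 8` (HOME FINDING-ZD-AXIS-CLASSES.md §2, §7).
-/

noncomputable section

open Finset
open scoped BigOperators
open Literature.Probability.LatticeModels
open Literature.Probability.RandomPlanarGeometry.SAW

namespace Literature.Probability.RandomPlanarGeometry.SAW.Zd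

section DegreeProfile

variable {u n : ℕ}

/-- The steps of a self-avoiding walk are unit coordinate vectors `± e_j`. [cite: MadrasSlade1993, §1.1 (p. 1); lane plumbing] -/
private theorem exists_step_single {D : ℕ} {ω : ℕ → Site D} (hω : ω ∈ saws D n) {k : ℕ} (hk : k < n) :
    ∃ j : Fin D, ∃ s : ℤ, (s = 1 ∨ s = -1) ∧ ω (k + 1) - ω k = Pi.single j s := by
  obtain ⟨j, hj | hj⟩ := (zdGraph_adj_iff_sub _ _).1 ((mem_saws.1 hω).2.2.1 k hk)
  · exact ⟨j, 1, Or.inl rfl, hj⟩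
  · refine ⟨j, -1, Or.inr rfl, ?_⟩
    rw [Pi.single_neg, ← hj, neg_sub]

/-- One step changes exactly one coordinate. [cite: MadrasSlade1993, §1.1 (p. 1); lane plumbing] -/
private theorem step_coord_unique {D : ℕ} {ω : ℕ → Site D} (hω : ω ∈ saws D n) {k : ℕ} (hk : k < n) {a b : Fin D}
    (ha : ω (k + 1) a ≠ ω k a) (hb : ω (k + 1) b ≠ ω k b) : a = b := by
  obtain ⟨j, s, -, hjs⟩ := exists_step_single hω hk
  have key : ∀ e : Fin D, ω (k + 1) e ≠ ω k e → e = j := by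
    intro e he
    by_contra hej
    have h := congrFun hjs e
    rw [Pi.sub_apply, Pi.single_eq_of_ne hej] at h
    exact he (sub_eq_zero.1 h)
  exact (key a ha).trans (key b hb).symm

/-- A vertical step changes the first coordinate by exactly `± 1`; an up step by `+1`. [cite: MadrasSlade1993, §1.1 (p. 1); lane plumbing] -/
private theorem step_apply_zero_le {D : ℕ} [NeZero D] {ω : ℕ → Site D} (hω : ω ∈ saws D n) {k : ℕ} (hk : k < n) :
    ω (k + 1) 0 - ω k 0 ≤ 1 ∧ (ω (k + 1) 0 < ω k 0 → ω (k + 1) 0 - ω k 0 = -1) := by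
  have h := abs_sub_le_one_of_adj ((mem_saws.1 hω).2.2.1 k hk) 0
  rw [abs_le] at h
  exact ⟨h.2, fun hlt => by omega⟩

/-- A coordinate that is nonzero at some time was changed by an earlier step. [cite: MadrasSlade1993, §1.1 (p. 1); lane plumbing] -/
private theorem exists_step_ne {D : ℕ} {ω : ℕ → Site D} (h0 : ω 0 = 0) {a : Fin D} {i : ℕ} (hi : ω i a ≠ 0) :
    ∃ k < i, ω (k + 1) a ≠ ω k a := by
  induction i with
  | zero => exact absurd (by rw [h0]; rfl) hi
  | succ i ih =>
    by_cases h : ω (i + 1) a = ω i a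
    · obtain ⟨k, hk, hne⟩ := ih (by rwa [h] at hi)
      exact ⟨k, by omega, hne⟩
    · exact ⟨i, by omega, h⟩

/-- ★ HEIGHT ACCOUNTING: for a self-avoiding walk of `ℤ^{u+1}` that uses every lateral axis, (final height) `+ u + 2·`(number of down
steps) `≤` length: the lateral steps are at least `u` (one per used axis, injectively), they do not move the height, every other step moves
it by `± 1`. [cite: MadrasSlade1993, §4.2, eq. (4.2.20)–(4.2.22) (cost = length − span); lane lemma] -/
theorem height_add_axes_add_two_mul_down_le {ω : ℕ → Site (u + 1)} (hω : ω ∈ saws (u + 1) n)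
    (hall : ∀ a : Fin (u + 1), a ≠ 0 → ∃ i ≤ n, ω i a ≠ (0 : ℤ)) :
    ω n 0 + u + 2 * (((Finset.range n).filter fun k => ω (k + 1) 0 < ω k 0).card : ℤ) ≤ n := by
  classical
  have h0 : ω 0 = 0 := (mem_saws.1 hω).1
  set Z := (Finset.range n).filter (fun k => ω (k + 1) 0 = ω k 0) with hZ
  set J := (Finset.range n).filter (fun k => ¬ ω (k + 1) 0 = ω k 0) with hJ
  have hZJ : Z.card + J.card = n := by
    rw [hZ, hJ, Finset.card_filter_add_card_filter_not, Finset.card_range]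
  -- (1) u ≤ Z.card
  have hch : ∀ a : Fin (u + 1), a ≠ 0 → ∃ k, k < n ∧ ω (k + 1) a ≠ ω k a := by
    intro a ha
    obtain ⟨i, hi, hne⟩ := hall a ha
    obtain ⟨k, hk, hk'⟩ := exists_step_ne h0 hne
    exact ⟨k, by omega, hk'⟩
  have h1 : u ≤ Z.card := by
    have hU : ((Finset.univ : Finset (Fin (u + 1))).filter (fun a => a ≠ 0)).card = u := by
      rw [Finset.filter_ne' Finset.univ (0 : Fin (u + 1)), Finset.card_erase_of_mem (Finset.mem_univ _),
        Finset.card_univ, Fintype.card_fin, Nat.add_sub_cancel]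
    rw [← hU]
    refine Finset.card_le_card_of_injOn (fun a => if h : a ≠ 0 then Classical.choose (hch a h) else 0) ?_ ?_
    · intro a ha
      rw [Finset.mem_coe, Finset.mem_filter] at ha
      have ha0 : a ≠ 0 := ha.2
      obtain ⟨hk, hne⟩ := Classical.choose_spec (hch a ha0)
      simp only [dif_pos ha0, Finset.mem_coe]
      rw [hZ, Finset.mem_filter, Finset.mem_range]
      refine ⟨hk, ?_⟩
      by_contra h00
      exact ha0 (step_coord_unique hω hk hne h00)
    · intro a ha b hb hab
      rw [Finset.mem_coe, Finset.mem_filter] at ha hb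
      have ha0 : a ≠ 0 := ha.2
      have hb0 : b ≠ 0 := hb.2
      simp only [ha0, hb0, ne_eq, not_false_eq_true, dif_pos] at hab
      obtain ⟨hk, hne⟩ := Classical.choose_spec (hch a ha0)
      obtain ⟨-, hne'⟩ := Classical.choose_spec (hch b hb0)
      rw [hab] at hne
      exact step_coord_unique hω (Classical.choose_spec (hch b hb0)).1 hne hne'
  -- (2) height = Σ_J δ ≤ (J.card − Dn.card) − Dn.card
  have htel : ω n 0 = ∑ k ∈ J, (ω (k + 1) 0 - ω k 0) := by
    have h := Finset.sum_range_sub (fun k => ω k 0) n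
    rw [h0] at h
    simp only [Pi.zero_apply, sub_zero] at h
    rw [← h, ← Finset.sum_filter_add_sum_filter_not (Finset.range n) (fun k => ω (k + 1) 0 = ω k 0)]
    have hZ0 : ∑ k ∈ Z, (ω (k + 1) 0 - ω k 0) = 0 :=
      Finset.sum_eq_zero fun k hk => by rw [(Finset.mem_filter.1 hk).2, sub_self]
    rw [← hZ, ← hJ, hZ0, zero_add]
  have hDnJ : ((Finset.range n).filter fun k => ω (k + 1) 0 < ω k 0) ⊆ J := by
    intro k hk
    rw [Finset.mem_filter] at hk
    rw [hJ, Finset.mem_filter]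
    exact ⟨hk.1, fun h => by rw [h] at hk; exact lt_irrefl _ hk.2⟩
  have h2 : ω n 0 + 2 * ((((Finset.range n).filter fun k => ω (k + 1) 0 < ω k 0).card : ℤ)) ≤ J.card := by
    have hsplit := Finset.sum_sdiff hDnJ (f := fun k => ω (k + 1) 0 - ω k 0)
    have hA : ∑ k ∈ J \ ((Finset.range n).filter fun k => ω (k + 1) 0 < ω k 0), (ω (k + 1) 0 - ω k 0) ≤
        ((J \ ((Finset.range n).filter fun k => ω (k + 1) 0 < ω k 0)).card : ℤ) := by
      calc ∑ k ∈ J \ ((Finset.range n).filter fun k => ω (k + 1) 0 < ω k 0), (ω (k + 1) 0 - ω k 0)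
          ≤ ∑ _k ∈ J \ ((Finset.range n).filter fun k => ω (k + 1) 0 < ω k 0), (1 : ℤ) :=
            Finset.sum_le_sum fun k hk =>
              (step_apply_zero_le hω (Finset.mem_range.1 (Finset.mem_filter.1 (Finset.mem_sdiff.1 hk).1).1)).1
        _ = ((J \ ((Finset.range n).filter fun k => ω (k + 1) 0 < ω k 0)).card : ℤ) := by simp
    have hB : ∑ k ∈ ((Finset.range n).filter fun k => ω (k + 1) 0 < ω k 0), (ω (k + 1) 0 - ω k 0) =
        -((((Finset.range n).filter fun k => ω (k + 1) 0 < ω k 0).card : ℤ)) := by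
      rw [Finset.sum_congr rfl (fun k hk => (step_apply_zero_le hω (Finset.mem_range.1 (Finset.mem_filter.1 hk).1)).2
        (Finset.mem_filter.1 hk).2)]
      simp
    have hcard : ((J \ ((Finset.range n).filter fun k => ω (k + 1) 0 < ω k 0)).card : ℤ) =
        J.card - (((Finset.range n).filter fun k => ω (k + 1) 0 < ω k 0).card : ℤ) := by
      rw [Finset.card_sdiff_of_subset hDnJ, Nat.cast_sub (Finset.card_le_card hDnJ)]
    rw [htel, ← hsplit, hB]
    linarith
  have h3 : (u : ℤ) ≤ Z.card := by exact_mod_cast h1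
  have h4 : (Z.card : ℤ) + J.card = n := by exact_mod_cast hZJ
  linarith

/-- ★ Every internal level gap of an irreducible bridge is crossed DOWNWARD: if `1 ≤ g` and `g + 1 ≤` span, some step goes from height
`g + 1` to height `g` (otherwise the last visit to level `g` before the first visit to `g + 1` is a renewal time).
[cite: MadrasSlade1993, §4.2, remark after Theorem 4.2.4 (p. 94: three crossings); lane lemma] -/
theorem exists_down_step_of_irreducible {D : ℕ} [NeZero D] {ω : ℕ → Site D} (hω : ω ∈ irreducibleBridges D n) {g : ℤ}
    (hg1 : 1 ≤ g) (hgA : g + 1 ≤ ω n 0) : ∃ t < n, ω t 0 = g + 1 ∧ ω (t + 1) 0 = g := by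
  classical
  obtain ⟨hb, hn1, hbr, hirr⟩ := mem_irreducibleBridges.1 hω
  obtain ⟨hωs, -⟩ := mem_bridges.1 hb
  obtain ⟨hω0, -, hadj, -⟩ := mem_saws.1 hωs
  have hstep : ∀ t, t < n → |ω (t + 1) 0 - ω t 0| ≤ 1 := fun t ht => abs_sub_le_one_of_adj (hadj t ht) 0
  by_contra hno'
  have hno : ∀ t, t < n → ω t 0 = g + 1 → ω (t + 1) 0 ≠ g := fun t ht h1 h2 => hno' ⟨t, ht, h1, h2⟩
  -- no down-crossing of the gap ⇒ once the height is ≥ g+1 it stays ≥ g+1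
  have hstay : ∀ t, t ≤ n → g + 1 ≤ ω t 0 → ∀ s, t ≤ s → s ≤ n → g + 1 ≤ ω s 0 := by
    intro t htn hgt s hts hsn
    induction s with
    | zero =>
      obtain rfl : t = 0 := by omega
      exact hgt
    | succ s ih =>
      rcases Nat.eq_or_lt_of_le hts with h | h
      · rw [← h]; exact hgt
      · have hs := ih (by omega) (by omega)
        have hst := hstep s (by omega)
        rw [abs_le] at hst
        by_contra hlt
        have heq : ω (s + 1) 0 = g ∧ ω s 0 = g + 1 := by omega
        exact hno s (by omega) heq.2 heq.1
  -- the first time with height ≥ g + 1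
  have hex : ∃ t, g + 1 ≤ ω t 0 := ⟨n, hgA⟩
  set t₁ := Nat.find hex with ht₁
  have ht₁g : g + 1 ≤ ω t₁ 0 := Nat.find_spec hex
  have hmin : ∀ s < t₁, ¬ g + 1 ≤ ω s 0 := fun s hs => Nat.find_min hex hs
  have ht₁n : t₁ ≤ n := Nat.find_min' hex hgA
  have ht₁0 : t₁ ≠ 0 := by
    intro h
    rw [h, hω0] at ht₁g
    simp at ht₁g
    omega
  obtain ⟨τ, hτ⟩ : ∃ τ, t₁ = τ + 1 := ⟨t₁ - 1, by omega⟩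
  have hτg : ω τ 0 = g := by
    have h1 := not_le.1 (hmin τ (by omega))
    have h2 := hstep τ (by omega)
    rw [abs_le, ← hτ] at h2
    omega
  -- τ is a renewal time: [0, τ] is a bridge and [τ, n] is a bridge
  have hτ1 : 1 ≤ τ := by
    by_contra h
    obtain rfl : τ = 0 := by omega
    rw [hω0] at hτg; simp at hτg; omega
  refine hirr τ hτ1 (by omega) ⟨by omega, ?_, ?_⟩
  · intro i hi1 hiτ
    have := hbr i hi1 (by omega)
    refine ⟨this.1, ?_⟩
    have h1 := not_le.1 (hmin i (by omega))
    rw [hτg]; omega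
  · intro j hj1 hjn
    have hs := hstay t₁ ht₁n ht₁g (τ + j) (by omega) (by omega)
    have := hbr (τ + j) (by omega) (by omega)
    show ω (τ + 0) 0 < ω (τ + j) 0 ∧ ω (τ + j) 0 ≤ ω (τ + (n - τ)) 0
    rw [add_zero, hτg, show τ + (n - τ) = n by omega]
    exact ⟨by omega, this.2⟩

/-- ★ An irreducible bridge of span `A` makes at least `A − 1` down steps. [cite: MadrasSlade1993, §4.2, remark after Theorem 4.2.4 (p. 94); lane lemma] -/
theorem span_sub_one_le_card_down {D : ℕ} [NeZero D] {ω : ℕ → Site D} (hω : ω ∈ irreducibleBridges D n) :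
    ω n 0 - 1 ≤ (((Finset.range n).filter fun k => ω (k + 1) 0 < ω k 0).card : ℤ) := by
  classical
  -- the down-crossing times of the internal gaps 1 … A−1 are pairwise distinct down steps
  obtain ⟨hb, hn1, hbr, -⟩ := mem_irreducibleBridges.1 hω
  have hA0 : 0 < ω n 0 := by
    have := (hbr n hn1 le_rfl).1
    rwa [(mem_saws.1 (mem_bridges.1 hb).1).1] at this
  set A := (ω n 0).toNat with hA
  have hAeq : (A : ℤ) = ω n 0 := Int.toNat_of_nonneg hA0.le
  have hch : ∀ g : Fin (A - 1), ∃ t, t < n ∧ ω t 0 = (g : ℕ) + 1 + 1 ∧ ω (t + 1) 0 = (g : ℕ) + 1 := by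
    intro g
    obtain ⟨t, ht, h1, h2⟩ := exists_down_step_of_irreducible hω (g := (g : ℕ) + 1) (by omega) (by have := g.isLt; omega)
    exact ⟨t, ht, by rw [h1], h2⟩
  choose tOf htOf using hch
  have hinj : Function.Injective tOf := by
    intro g g' hgg
    have h1 := (htOf g).2.2
    have h2 := (htOf g').2.2
    rw [hgg] at h1
    rw [h1] at h2
    exact Fin.ext (by exact_mod_cast (show ((g : ℕ) : ℤ) = (g' : ℕ) by omega))
  have hsub : Finset.univ.image tOf ⊆ (Finset.range n).filter fun k => ω (k + 1) 0 < ω k 0 := by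
    intro t ht
    obtain ⟨g, -, rfl⟩ := Finset.mem_image.1 ht
    rw [Finset.mem_filter, Finset.mem_range]
    exact ⟨(htOf g).1, by rw [(htOf g).2.1, (htOf g).2.2]; omega⟩
  have hcard := Finset.card_le_card hsub
  rw [Finset.card_image_of_injective _ hinj, Finset.card_univ, Fintype.card_fin] at hcard
  have : ((A - 1 : ℕ) : ℤ) ≤ (((Finset.range n).filter fun k => ω (k + 1) 0 < ω k 0).card : ℤ) := by exact_mod_cast hcard
  omega

/-- ★★ THE AXIS BOUND: a cost-`c`, length-`n` irreducible bridge of `ℤ^{u+1}` using every lateral axis has `u ≤ 3c − 2n + 2`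
(span `A = n − c`, at least `A − 1` down steps, height accounting) — so `F_{c,n}(u) = 0` whenever `3c + 2 < 2n + u`.
[cite: MadrasSlade1993, §1.1 eq. (1.1.8) p. 5; §4.2, remark after Theorem 4.2.4 (p. 94); lane theorem] -/
theorem card_allAxesClass_eq_zero_of_lt {u c n : ℕ} (h : 3 * c + 2 < 2 * n + u) :
    ((irreducibleBridges (u + 1) n).filter fun (ω : ℕ → Site (u + 1)) => costZd u n ω = c ∧
        ∀ a : Fin (u + 1), a ≠ 0 → ∃ i ≤ n, ω i a ≠ (0 : ℤ)).card = 0 := by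
  classical
  rw [Finset.card_eq_zero, Finset.filter_eq_empty_iff]
  rintro ω hω ⟨hcost, hall⟩
  have hsaw : ω ∈ saws (u + 1) n := (mem_bridges.1 (mem_irreducibleBridges.1 hω).1).1
  have h1 := height_add_axes_add_two_mul_down_le hsaw hall
  have h2 := span_sub_one_le_card_down hω
  obtain ⟨hb, hn1, hbr, -⟩ := mem_irreducibleBridges.1 hω
  have hA0 : 0 < ω n 0 := by
    have := (hbr n hn1 le_rfl).1
    rwa [(mem_saws.1 hsaw).1] at this
  have hAeq : ((ω n 0).toNat : ℤ) = ω n 0 := Int.toNat_of_nonneg hA0.le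
  unfold costZd at hcost
  omega

/-- ★★★ THE DEGREE PROFILE: for every cost `c` and length `n`, `d ↦ N_{c,n}(ℤ^{d+1})` is (the restriction to `ℕ` of) a polynomial over
`ℚ` of degree `≤ 3c + 2 − 2n` (truncated). With the top class (`…ZdTopSymbol`): degree `c` only on the span-one cell `n = c + 1`; the
cells of maximal span are at most quadratic. [cite: MadrasSlade1993, §1.1 eq. (1.1.8) p. 5; §4.2, remark after Theorem 4.2.4 (p. 94); lane theorem] -/
theorem exists_polynomial_costCoeffZd_degree_profile (c n : ℕ) :
    ∃ P : Polynomial ℚ, P.natDegree ≤ 3 * c + 2 - 2 * n ∧ ∀ d : ℕ, (costCoeffZd d c n : ℚ) = P.eval (d : ℚ) := by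
  classical
  set F : ℕ → ℕ := fun u => ((irreducibleBridges (u + 1) n).filter fun (ω : ℕ → Site (u + 1)) => costZd u n ω = c ∧
      ∀ a : Fin (u + 1), a ≠ 0 → ∃ i ≤ n, ω i a ≠ (0 : ℤ)).card with hF
  have hNF : ∀ d, costCoeffZd d c n = ∑ u ∈ Finset.range (c + 1), d.choose u * F u := fun d =>
    costCoeffZd_eq_sum_choose_mul d c n
  have hFz : ∀ u, 3 * c + 2 - 2 * n < u → F u = 0 := by
    intro u hu
    rw [hF]
    exact card_allAxesClass_eq_zero_of_lt (by omega)
  refine ⟨∑ u ∈ Finset.range (c + 1), Polynomial.C ((F u : ℚ) / (u.factorial : ℚ)) * descPochhammer ℚ u, ?_, ?_⟩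
  · refine Polynomial.natDegree_sum_le_of_forall_le _ _ fun u _ => ?_
    by_cases hu : 3 * c + 2 - 2 * n < u
    · rw [hFz u hu]; simp
    · calc (Polynomial.C ((F u : ℚ) / (u.factorial : ℚ)) * descPochhammer ℚ u).natDegree
          ≤ (descPochhammer ℚ u).natDegree := Polynomial.natDegree_C_mul_le _ _
        _ = u := descPochhammer_natDegree ℚ u
        _ ≤ 3 * c + 2 - 2 * n := by omega
  · intro d
    rw [hNF d, Polynomial.eval_finsetSum]
    push_cast
    refine Finset.sum_congr rfl fun u _ => ?_
    have hf : (u.factorial : ℚ) ≠ 0 := by exact_mod_cast u.factorial_ne_zero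
    rw [Polynomial.eval_mul, Polynomial.eval_C, descPochhammer_eval_eq_descFactorial ℚ d u,
      Nat.descFactorial_eq_factorial_mul_choose, Nat.cast_mul, div_mul_eq_mul_div, mul_div_assoc,
      mul_div_cancel_left₀ _ hf, mul_comm]

/-! ### Finite determination: an all-`d` law is decided by finitely many dimensions -/

/-- Two rational polynomials of degree `≤ m` that agree at `d = 0, 1, …, m` are equal. [cite: MadrasSlade1993, §1.1 (1.1.8); lane plumbing] -/
private theorem poly_eq_of_eval_nat_eq {P Q : Polynomial ℚ} {m : ℕ} (hP : P.natDegree ≤ m) (hQ : Q.natDegree ≤ m)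
    (h : ∀ v : ℕ, v ≤ m → P.eval (v : ℚ) = Q.eval (v : ℚ)) : P = Q := by
  have hsub : P - Q = 0 := by
    refine Polynomial.eq_zero_of_natDegree_lt_card_of_eval_eq_zero (P - Q) (ι := Fin (m + 1))
      (f := fun i => ((i : ℕ) : ℚ)) ?_ ?_ ?_
    · intro i j hij
      have hij' : ((i : ℕ) : ℚ) = ((j : ℕ) : ℚ) := hij
      exact Fin.ext (by exact_mod_cast hij')
    · intro i
      rw [Polynomial.eval_sub, h i (by have := i.isLt; omega), sub_self]
    · calc (P - Q).natDegree ≤ m := (Polynomial.natDegree_sub_le _ _).trans (max_le hP hQ)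
        _ < Fintype.card (Fin (m + 1)) := by rw [Fintype.card_fin]; exact Nat.lt_succ_self m
  exact sub_eq_zero.1 hsub

/-- ★★ FINITE DETERMINATION OF THE CENSUS: a candidate all-`d` law `Q ∈ ℚ[X]` of degree `≤ 3c + 2 − 2n` for `N_{c,n}(ℤ^{d+1})` that is
correct in the dimensions `d + 1 = 1, …, 3c + 3 − 2n` is correct in EVERY dimension. (E.g. the three-slack law for `N_{7,9}` — degree
`≤ 5` — is decided by `ℤ¹, …, ℤ⁶`.) [cite: MadrasSlade1993, §1.1 eq. (1.1.8) p. 5; lane theorem] -/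
theorem costCoeffZd_eq_eval_of_eq_on_small (c n : ℕ) {Q : Polynomial ℚ} (hQ : Q.natDegree ≤ 3 * c + 2 - 2 * n)
    (h : ∀ v : ℕ, v ≤ 3 * c + 2 - 2 * n → (costCoeffZd v c n : ℚ) = Q.eval (v : ℚ)) (d : ℕ) :
    (costCoeffZd d c n : ℚ) = Q.eval (d : ℚ) := by
  obtain ⟨P, hP, hPev⟩ := exists_polynomial_costCoeffZd_degree_profile c n
  have hPQ : P = Q := poly_eq_of_eval_nat_eq hP hQ fun v hv => by rw [← hPev v, h v hv]
  rw [hPev d, hPQ]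

/-- ★★ FINITE DETERMINATION OF THE LARGE-FORCE COEFFICIENTS: a candidate all-`d` law `Q ∈ ℚ[X]` of degree `≤ k` for `c_k^{(d)}` that is
correct for `d = 0, …, k` is correct for every `d` (with `…ZdTopSymbol`'s degree drop, `d ≤ k − 1` suffices for `k ≥ 2`; not used here to
keep this file on the `…ZdCostPolynomial` olean only). [cite: MadrasSlade1993, §1.1 eq. (1.1.8) p. 5; lane theorem] -/
theorem largeForceCoeffZd_eq_eval_of_eq_on_small (k : ℕ) {Q : Polynomial ℚ} (hQ : Q.natDegree ≤ k)
    (h : ∀ v : ℕ, v ≤ k → (largeForceCoeffZd v k : ℚ) = Q.eval (v : ℚ)) (d : ℕ) :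
    (largeForceCoeffZd d k : ℚ) = Q.eval (d : ℚ) := by
  obtain ⟨P, hP, hPev⟩ := exists_polynomial_largeForceCoeffZd k
  have hPQ : P = Q := poly_eq_of_eval_nat_eq hP hQ fun v hv => by rw [← hPev v, h v hv]
  rw [hPev d, hPQ]

end DegreeProfile

end Literature.Probability.RandomPlanarGeometry.SAW.Zd
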